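import Literature.AlgebraicGeometry.AbelianSchemes.LevelStructureOfIsogeny
import Literature.AlgebraicGeometry.AbelianSchemes.FibreHomPointsOfFibrePoints
import Literature.AlgebraicGeometry.AbelianSchemes.IsLambdaOfAtAlongIsogeny
import Literature.AlgebraicGeometry.AbelianSchemes.PolarizedAbelianSchemeWithLevel
import HarnessLib

/-!
# The level-`n` structure on the DUAL abelian scheme induced by a polarisation of type prime to `n`

Layer `Literature/AlgebraicGeometry/AbelianSchemes`, namespaces `Literature.AlgebraicGeometry.AbelianSchemes.AbelianSchemeOver(.Polarization)`
(§1) and `Literature.AlgebraicGeometry.AbelianSchemes.PolarizedAbelianSchemeWithLevel` (§2).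
THEOREMS ONLY (no definition, no named fact, no instance).

[MumfordFogartyKirwan1994] Ch. 7 §1 Def. 7.1 / App. 7A and [MumfordAV1970] §7 Thm. 4: a homomorphism of abelian schemes whose
geometric-fibre kernels are killed by an integer `m` prime to `n` and which is onto on geometric fibre points carries level-`n`
structures to level-`n` structures (★ `LevelStructureOfIsogeny.LevelStructure.exists_comp_of_torsionBijOn`).  Applied to a
POLARISATION `λ : A → Â` of type `δ` ([MumfordFogartyKirwan1994] App. 7A: the kernel of `λ_s` on points is `(∏ᵢ ℤ/δᵢ)²`, ★
`Polarization.HasType`) with `(∏ᵢ δᵢ, n) = 1` and a level-`N` structure `σ` on `A` with `N = n·d`: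

* §1 `Polarization.HasType.pow_prod_eq_one_of_comp_lam_eq_one` — on every geometric fibre, a point killed by `λ` is killed by
  `∏ᵢ δᵢ` (★ `HasType.exists_mulHom`, read in the `FibrePoints` currency through ★ `FibreHomPointsOfFibrePoints` and ★
  `fibrePointToLeft_pow`); `Polarization.HasType.eq_one_of_pow_eq_one_of_comp_lam_eq_one` — hence `λ` is injective on
  `n`-torsion geometric fibre points.
* §2 **`PolarizedAbelianSchemeWithLevel.exists_hatLevelStructure_of_torsionSurj`** — if every `n`-torsion geometric fibre
  point of `Â` is `x ≫ λ` for an `n`-torsion `x`, then `(σᵢ^d ≫ λ)ᵢ` is a level-`n` structure on `Â` (**«`Â[n]` is CONSTANT,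
  `= λ(A[n])`, spanned by the level sections»** in the tree's currency: `basis_injective` / `basis_surjective` at every
  algebraically closed `Ω`); **`exists_hatLevelStructure`** — the same from «`λ` onto on geometric fibre points» (★
  `exists_pow_eq_one_and_comp_eq`); `hatLevelStructure_unique` (★ `ext_σ`).

The surjectivity input is a BINDER (`hsurjn` / `hsurj`): for an abstract ★ `DualPair` the tree does not pin `dim Â_s`, so
«`λ_s` onto» ([MumfordAV1970] §8 Thm. 1, ★ over `ℂ` only: `Motives/AbelianVarietyPicZeroOfAmple`) is not derivable from ★
`IsLambdaOfAt` alone at a general algebraically closed `Ω`.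

Cell `hodgecm-mathlib` (D-0151), HECKE-LINK H2/D6 (u5) «Hecke instantiation of (K)'s constancy» (B-plan1 (g14) 21:37:50Z): the
`φ : LevelStructure g n B′` binder (`B′ = Â′`) of ★ (K) `PoincarePullbackStabilizerConstant.stabilizer_le_of_torsion_of_character`
(B-p09 (g10) p747184) in the Siegel situation `P′ : PolarizedAbelianSchemeWithLevel g N′ δ S″`, `n ∣ N′`, `(∏ δᵢ, n) = 1`.
Count-neutral; HC_CM is proved only modulo the 7 printed citations until rung 0 closes.

## References
* [MumfordFogartyKirwan1994] D. Mumford, J. Fogarty, F. Kirwan, *GIT* 3rd ed. (1994), Ch. 7 §1 Def. 7.1 (p. 129), App. 7A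
  (pp. 234–235).
* [MumfordAV1970] D. Mumford, *Abelian Varieties* (1970), §7 Thm. 4 (p. 72), §8 Thm. 1 (p. 77), §23 (p. 231).
-/

set_option autoImplicit false

noncomputable section

universe u

open CategoryTheory CategoryTheory.Limits AlgebraicGeometry
open Literature.AlgebraicGeometry.Motives
open scoped MonObj

namespace Literature.AlgebraicGeometry.AbelianSchemes

namespace AbelianSchemeOver

variable {S : Scheme.{u}} {A : AbelianSchemeOver S}

/-! ## §1 The kernel of a polarisation of type `δ` is killed by `∏ᵢ δᵢ`; `λ` is injective on `n`-torsion for `(∏ δ, n) = 1` -/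

namespace Polarization

variable {D : A.DualPair} {pol : A.Polarization D} {g : ℕ} {δ : Fin g → ℕ}

/-- In `(∏ᵢ ℤ/δᵢ)²` every element is killed by `∏ᵢ δᵢ`. [cite: MumfordFogartyKirwan1994, App. 7A (pp. 234–235)] -/
theorem pow_prod_eq_one_typeGroup
    (v : Multiplicative (((i : Fin g) → ZMod (δ i)) × ((i : Fin g) → ZMod (δ i)))) :
    v ^ (∏ i, δ i) = 1 := by
  have key : ∀ w : ((i : Fin g) → ZMod (δ i)), (∏ i, δ i) • w = 0 := by
    intro w
    funext i
    rw [Pi.smul_apply, Pi.zero_apply, nsmul_eq_mul,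
      (ZMod.natCast_eq_zero_iff _ _).2 (Finset.dvd_prod_of_mem δ (Finset.mem_univ i)), zero_mul]
  change Multiplicative.ofAdd ((∏ i, δ i) • Multiplicative.toAdd v) = Multiplicative.ofAdd 0
  rw [Prod.smul_mk (∏ i, δ i) (Multiplicative.toAdd v).1 (Multiplicative.toAdd v).2, key, key]
  rfl

/-- **The kernel of a polarisation of type `δ` is killed by `∏ᵢ δᵢ` on every geometric fibre** (`FibrePoints` currency):
`x ≫ λ = 1 ⟹ x^{∏ δᵢ} = 1` — the partner `Ω`-point of `x` lies in `kerPointsAt = (∏ᵢ ℤ/δᵢ)²` (★ `HasType`, ★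
`FibreHomPointsOfFibrePoints`), and powers correspond (★ `fibrePointToLeft_pow`). [cite: MumfordFogartyKirwan1994, App. 7A (pp. 234–235)] -/
theorem HasType.pow_prod_eq_one_of_comp_lam_eq_one [IsMonHom pol.lam] (hT : pol.HasType δ)
    ⦃Ω : Type u⦄ [Field Ω] [IsAlgClosed Ω] (s : Spec (.of Ω) ⟶ S) (x : A.FibrePoints s) (hx : x ≫ pol.lam = 1) :
    x ^ (∏ i, δ i) = 1 := by
  obtain ⟨P, hP⟩ := A.exists_points_fibrePointToLeft_eq s x
  -- `λ_s(P) = 1`, so `P ∈ K(λ̄) = im((∏ ℤ/δᵢ)²)`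
  have h1 : AlgPoints.map (fibreHom pol.lam s).hom.hom.hom P = 1 := (map_fibreHom_eq_one_iff_comp_eq_one s pol.lam hP).2 hx
  have hmem : P ∈ pol.kerPointsAt s := by
    rw [← setOf_algPointsMap_fibreHom_eq_one_eq_kerPointsAt pol s]; exact h1
  obtain ⟨φ, -, hrange⟩ := Polarization.HasType.exists_mulHom pol hT Ω s
  rw [← hrange] at hmem
  obtain ⟨v, rfl⟩ := hmem
  have hPm : φ v ^ (∏ i, δ i) = 1 := by rw [← map_pow, pow_prod_eq_one_typeGroup, map_one]
  -- transport `P^{∏δ} = 1` to `x^{∏δ} = 1` through the partner dictionary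
  apply Over.OverMorphism.ext
  have e1 : (x ^ (∏ i, δ i)).left = x.left ≫ ((𝟙 A.X : A.X ⟶ A.X) ^ (∏ i, δ i)).left := by
    rw [← Over.comp_left, MonObj.comp_pow, Category.comp_id]
  have e3 : A.fibrePointToLeft s (φ v) ≫ ((𝟙 A.X : A.X ⟶ A.X) ^ (∏ i, δ i)).left = A.fibrePointToLeft s 1 := by
    rw [← A.fibrePointToLeft_pow s (φ v) (∏ i, δ i), hPm]
  rw [e1, ← A.fibrePointToLeft_one_eq s, ← e3]
  exact (congrArg (fun t => t ≫ ((𝟙 A.X : A.X ⟶ A.X) ^ (∏ i, δ i)).left) hP).symm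

/-- **`λ` is injective on `n`-torsion geometric fibre points when `(∏ δᵢ, n) = 1`** ([MumfordAV1970] §7 Thm. 4 arithmetic:
★ `eq_one_of_pow_eq_one_of_comp_eq_one`). [cite: MumfordAV1970, §7 Thm. 4 (p. 72)] [cite: MumfordFogartyKirwan1994, App. 7A (pp. 234–235)] -/
theorem HasType.eq_one_of_pow_eq_one_of_comp_lam_eq_one [IsMonHom pol.lam] (hT : pol.HasType δ) {n : ℕ}
    (hcop : Nat.Coprime (∏ i, δ i) n) ⦃Ω : Type u⦄ [Field Ω] [IsAlgClosed Ω] (s : Spec (.of Ω) ⟶ S)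
    (x : A.FibrePoints s) (hn : x ^ n = 1) (hx : x ≫ pol.lam = 1) : x = 1 :=
  eq_one_of_pow_eq_one_of_comp_eq_one pol.lam hcop hT.pow_prod_eq_one_of_comp_lam_eq_one s x hn hx

end Polarization

end AbelianSchemeOver

/-! ## §2 The induced level-`n` structure on `Â` -/

namespace PolarizedAbelianSchemeWithLevel

open AbelianSchemeOver

variable {S : Scheme.{u}} {g N : ℕ} {δ : Fin g → ℕ} (P : PolarizedAbelianSchemeWithLevel g N δ S)

/-- **«`Â[n]` IS CONSTANT, SPANNED BY `λ` OF THE LEVEL SECTIONS»** — for `P = (A, λ, σ)` of type `δ` and level `N = n·d` with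
`(∏ δᵢ, n) = 1`, IF every `n`-torsion geometric fibre point of `Â` is `x ≫ λ` for an `n`-torsion `x` (`hsurjn`), then
`(σᵢ^d ≫ λ)ᵢ` is a level-`n` structure on the dual abelian scheme `Â` (★ `exists_comp_of_torsionBijOn` with §1's injectivity).
[cite: MumfordFogartyKirwan1994, Ch. 7 §1 Definition 7.1 (p. 129) and App. 7A (pp. 234–235)] [cite: MumfordAV1970, §7 Thm. 4 (p. 72)] -/
theorem exists_hatLevelStructure_of_torsionSurj {n d : ℕ} (hd : N = n * d) (hN : N ≠ 0)
    (hcop : Nat.Coprime (∏ i, δ i) n)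
    (hsurjn : ∀ ⦃Ω : Type u⦄ [Field Ω] [IsAlgClosed Ω] (s : Spec (.of Ω) ⟶ S) (y : P.D.hat.FibrePoints s),
      y ^ n = 1 → ∃ x : P.A.FibrePoints s, x ^ n = 1 ∧ x ≫ P.pol.lam = y) :
    ∃ χ : P.D.hat.LevelStructure g n, ∀ i, χ.σ i = (P.level.changeLevel n d hd hN).σ i ≫ P.pol.lam := by
  haveI := P.pol.isMonHom
  exact (P.level.changeLevel n d hd hN).exists_comp_of_torsionBijOn P.pol.lam
    (P.hasType.eq_one_of_pow_eq_one_of_comp_lam_eq_one hcop) hsurjn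

/-- **The level-`n` structure `(σᵢ^d ≫ λ)ᵢ` on `Â` from «`λ` onto on geometric fibre points»** (`hsurj`; the `n`-torsion lift
is then automatic, ★ `exists_pow_eq_one_and_comp_eq`).  This is the `φ : LevelStructure g n Â′` input of ★ (K)
`stabilizer_le_of_torsion_of_character` in the Siegel situation.
[cite: MumfordFogartyKirwan1994, Ch. 7 §1 Definition 7.1 (p. 129) and App. 7A (pp. 234–235)] [cite: MumfordAV1970, §7 Thm. 4 (p. 72)] -/
theorem exists_hatLevelStructure {n d : ℕ} (hd : N = n * d) (hN : N ≠ 0) (hcop : Nat.Coprime (∏ i, δ i) n)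
    (hsurj : ∀ ⦃Ω : Type u⦄ [Field Ω] [IsAlgClosed Ω] (s : Spec (.of Ω) ⟶ S) (y : P.D.hat.FibrePoints s),
      ∃ x : P.A.FibrePoints s, x ≫ P.pol.lam = y) :
    ∃ χ : P.D.hat.LevelStructure g n, ∀ i, χ.σ i = (P.level.changeLevel n d hd hN).σ i ≫ P.pol.lam := by
  haveI := P.pol.isMonHom
  exact P.exists_hatLevelStructure_of_torsionSurj hd hN hcop
    (exists_pow_eq_one_and_comp_eq P.pol.lam hcop hsurj P.hasType.pow_prod_eq_one_of_comp_lam_eq_one)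

/-- **Uniqueness**: the induced level-`n` structure on `Â` is determined by its sections (★ `ext_σ`).
[cite: MumfordFogartyKirwan1994, Ch. 7 §1 Definition 7.1 (p. 129)] -/
theorem hatLevelStructure_unique {n d : ℕ} (hd : N = n * d) (hN : N ≠ 0) (χ₁ χ₂ : P.D.hat.LevelStructure g n)
    (h₁ : ∀ i, χ₁.σ i = (P.level.changeLevel n d hd hN).σ i ≫ P.pol.lam)
    (h₂ : ∀ i, χ₂.σ i = (P.level.changeLevel n d hd hN).σ i ≫ P.pol.lam) : χ₁ = χ₂ :=
  LevelStructure.ext_σ (funext fun i => (h₁ i).trans (h₂ i).symm)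

end PolarizedAbelianSchemeWithLevel

end Literature.AlgebraicGeometry.AbelianSchemes

end
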